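import Literature.AlgebraicGeometry.ShimuraVarieties.UnitaryBallClassMap
import Literature.NumberTheory.Automorphic.ThetaClassLevelChange
import HarnessLib

/-!
# Theta classes of a ball quotient surface under the level coverings

Reproduction (Literature), junction of tree theorems: kernel-checked consequences; no new axioms,
no records, every declaration kernel-checked.

Let `X' ⟶ X` be a covering of compact ball quotient surfaces with uniformization data
`D : UnitaryBallUniformisationDatum 2 X`, `D' : UnitaryBallUniformisationDatum 2 X'`, Sylvester frames `𝔣`, `𝔣'`
with the SAME underlying matrix (`𝔣'.t = 𝔣.t`) and compatible uniformizations on the cone of `D'`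
(`AlgPoints.map f (D'.unif v) = D.unif v`). For any archimedean restriction situation
`ιinf : U(2,1) →* G_U(𝔸)` (two adelic levels `ΓU`, `ΓU'`, arithmetic groups `D.ballImage 𝔣`,
`D'.ballImage 𝔣'`) and spaces of adelic forms `Θ`, `Θ'` such that every form of `Θ` has the
underlying function of a form of `Θ'` (e.g. `ΓU' ≤ ΓU` and `Θ ↪ Θ'` by `WeightForms.mono_left`):

* `pull_baseChange_mem_thetaClasses_of_restrict_eq` — the LEVEL-INDEXED form: two adelic restriction
  situations at the two levels (the `K`-type data may vary with the level), `Θ ↪ Θ'` after restriction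
  to `U(2,1)`; an instance of `WeightForms.thetaClasses_map_mem_of_restrict_eq`;
* `pull_baseChange_mem_thetaClasses` — **the pullback `(f^* ⊗ ℂ)` of a theta class of
  `(D.classMapDatum …, Θ)` is a theta class of `(D'.classMapDatum …, Θ')`** — the `saturate` clause of
  the theta/ball dictionary ("theta one-form sets are saturated under pullback by the level coverings"),
  reduced to (i) `f^*` preserves `F¹` (`BettiUniverse.pull_hodge`, Voisin I §7.3.2), (ii) naturality of
  the holomorphic lift under the covering (`classLift_pull`, hence of `classPull` as functions on
  `U(2,1)`: `coe_classPull_pull_baseChange`), (iii) holomorphy of a weight form depends only on its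
  function on the group (`BallForms.mem_holWeightForms_of_coe_eq`), via the abstract change-of-level
  lemma `WeightForms.thetaClasses_map_mem`;
* `pull_baseChange_mem_thetaClasses_of_le` — the standard case `ΓU' ≤ ΓU`;
* `thetaClasses_image_pull_baseChange_subset` — as an inclusion of images.

References: A. Borel, *Automorphic forms on SL₂(ℝ)* (1997), §5.13–5.14 [cite: Borel1997, §5.14];
C. Voisin, *Hodge Theory and Complex Algebraic Geometry I* (2002), §7.3.2 [cite: VoisinHodgeI2002, §7.3.2].
-/

noncomputable section

open Matrix MulAction Function Set
open scoped TensorProduct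
open Literature.Geometry.ComplexHyperbolic
open Literature.Geometry.ComplexHyperbolic.BallModel (U21 Ball Jac x₀)
open Literature.NumberTheory.Automorphic
open Literature.NumberTheory.Automorphic.AutomorphyFactor
open Literature.NumberTheory.Automorphic.WeightForms (ClassMapDatum thetaClasses IsLevelCorrected
  IsWeightMatched restrictHom thetaClasses_map_mem thetaClasses_map_mem_of_restrict_eq)
open Literature.AlgebraicGeometry.HodgeTheory
open Literature.AlgebraicGeometry.Motives (bettiCohomology)

namespace Literature.AlgebraicGeometry.ShimuraVarieties

/-! ### Holomorphy of a weight form is a property of its function on the group -/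

namespace BallForms

/-- **Holomorphic weight forms under change of group**: a weight form for `Δ'` with the same function
on `U(2,1)` as a HOLOMORPHIC weight form for `Δ` is holomorphic (both are read on the ball through the
same section of the orbit map, `mem_holWeightForms_iff`). [cite: Borel1997, Lemma 5.13 and §5.14] -/
theorem mem_holWeightForms_of_coe_eq {W : Type*} [NormedAddCommGroup W] [NormedSpace ℂ W]
    {Δ Δ' : Subgroup U21} {A : U21 → Ball → Module.End ℂ W} (hA : IsPullbackCocycle A)
    {g : weightForms Δ (stabilizer U21 x₀).subtype (hA.weightOf x₀)} (hg : g ∈ holWeightForms Δ hA)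
    {g' : weightForms Δ' (stabilizer U21 x₀).subtype (hA.weightOf x₀)}
    (h : (g' : U21 → W) = (g : U21 → W)) : g' ∈ holWeightForms Δ' hA := by
  obtain ⟨s, hs⟩ := exists_section
  rw [mem_holWeightForms_iff hA hs] at hg ⊢
  have hfun : ((factorFormsEquiv hA hs (Γ := Δ')).symm g' : Ball → W) =
      ((factorFormsEquiv hA hs (Γ := Δ)).symm g : Ball → W) := by
    funext x
    rw [factorFormsEquiv_symm_apply, factorFormsEquiv_symm_apply, ofGroup_apply, ofGroup_apply, h]
  rw [hfun]
  exact hg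

end BallForms

/-! ### Theta classes of a ball quotient under a covering -/

namespace UnitaryBallUniformisationDatum

variable {X X' : Motives.SchemeOver ℂ} (D : UnitaryBallUniformisationDatum 2 X)
  (D' : UnitaryBallUniformisationDatum 2 X')
variable (𝔣 : D.SylvesterFrame) (𝔣' : D'.SylvesterFrame)

/-- `f^* ⊗ ℂ` maps `F¹H¹(X)` into `F¹H¹(X')` (pull-back is a morphism of Hodge structures, granted
`hI`). [cite: VoisinHodgeI2002, §7.3.2] -/
theorem pull_baseChange_mem_hodge_F_one
    (hHD : exists_isReal_hodgeModel) (hI : hodgePQ_independent_of_hodgeModel)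
    (f : X' ⟶ X) {c : ℂ ⊗[ℚ] bettiCohomology X 1}
    (hc : c ∈ (BettiUniverse.hodge hHD D.isSmoothProjective 1).F 1) :
    (BettiUniverse.pull f 1).baseChange ℂ c ∈ (BettiUniverse.hodge hHD D'.isSmoothProjective 1).F 1 :=
  BettiUniverse.pull_hodge hHD hI D'.isSmoothProjective D.isSmoothProjective f 1 1 ⟨c, hc, rfl⟩

/-- **Naturality of the class pull map under the covering**, as functions on `U(2,1)`:
`classPull' (f^* c) = classPull c` for `c ∈ F¹H¹(X)` (from `classLift_pull`). [cite: Borel1997, §5.14] -/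
theorem coe_classPull_pull_baseChange
    (hHD : exists_isReal_hodgeModel) (hI : hodgePQ_independent_of_hodgeModel)
    (f : X' ⟶ X) (hT : 𝔣'.t = 𝔣.t)
    (hf : ∀ v ∈ D'.cone, Motives.AlgPoints.map f (D'.unif v) = D.unif v)
    {c : ℂ ⊗[ℚ] bettiCohomology X 1} (hc : c ∈ (BettiUniverse.hodge hHD D.isSmoothProjective 1).F 1) :
    (D'.classPull hHD 𝔣' ((BettiUniverse.pull f 1).baseChange ℂ c) : U21 → (Fin 2 → ℂ)) =
      (D.classPull hHD 𝔣 c : U21 → (Fin 2 → ℂ)) := by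
  rw [coe_classPull, coe_classPull, D.classLift_pull hHD 𝔣 hI D' 𝔣' f hT hf hc]

section ThetaClasses

variable {GU : Type*} [Group GU] {Kc : Type*} [Group Kc]
variable {ΓU ΓU' : Subgroup GU} {κ : Kc →* GU} {τ : Representation ℂ Kc (Fin 2 → ℂ)}
variable (ιinf : U21 →* GU) {η₁ : stabilizer U21 x₀ →* Kc}
  (hΔ : IsLevelCorrected ΓU κ τ ιinf (D.ballImage 𝔣))
  (hΔ' : IsLevelCorrected ΓU' κ τ ιinf (D'.ballImage 𝔣'))
  (hη : IsWeightMatched κ τ ιinf (stabilizer U21 x₀).subtype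
    (BallForms.isPullbackCocycle_cotangentCocycle.weightOf x₀) η₁)

/-- **Theta classes under the level coverings, across two adelic situations.** For a covering
`f : X' ⟶ X` of ball quotient surfaces with frames of equal matrix and compatible uniformizations, and
two archimedean restriction situations `ιinf : U(2,1) →* GU` (level `ΓU`, `K`-type `(Kc, κ, τ)`, at `X`)
and `ιinf' : U(2,1) →* GU'` (level `ΓU''`, `K`-type `(Kc', κ', τ')`, at `X'`) sharing the classical side
(`U(2,1)`, the stabilizer of the base point, the cotangent weight), and spaces of adelic forms `Θ`, `Θ'`
such that every form of `Θ` restricts on `U(2,1)` to the restriction of a form of `Θ'`: the pullback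
`(f^* ⊗ ℂ) c` of a theta class `c ∈ thetaClasses ιinf (D.classMapDatum …) Θ` is a theta class of
`(D'.classMapDatum …, Θ')` — the level-INDEXED form of the saturation (the `K`-type data may vary with
the level). [cite: Borel1997, §5.14] [cite: VoisinHodgeI2002, §7.3.2] -/
theorem pull_baseChange_mem_thetaClasses_of_restrict_eq
    (hHD : exists_isReal_hodgeModel) (hI : hodgePQ_independent_of_hodgeModel)
    {GU' : Type*} [Group GU'] {Kc' : Type*}
    [Group Kc'] {ΓU'' : Subgroup GU'} {κ' : Kc' →* GU'} {τ' : Representation ℂ Kc' (Fin 2 → ℂ)}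
    (ιinf' : U21 →* GU') {η₁' : stabilizer U21 x₀ →* Kc'}
    (hΔ'' : IsLevelCorrected ΓU'' κ' τ' ιinf' (D'.ballImage 𝔣'))
    (hη' : IsWeightMatched κ' τ' ιinf' (stabilizer U21 x₀).subtype
      (BallForms.isPullbackCocycle_cotangentCocycle.weightOf x₀) η₁')
    (f : X' ⟶ X) (hT : 𝔣'.t = 𝔣.t)
    (hf : ∀ v ∈ D'.cone, Motives.AlgPoints.map f (D'.unif v) = D.unif v)
    {Θ : Submodule ℂ (weightForms ΓU κ τ)} {Θ' : Submodule ℂ (weightForms ΓU'' κ' τ')}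
    (hΘ : ∀ F ∈ Θ, ∃ F' ∈ Θ', (restrictHom ιinf' hΔ'' hη' F' : U21 → (Fin 2 → ℂ)) =
      (restrictHom ιinf hΔ hη F : U21 → (Fin 2 → ℂ)))
    {c : ℂ ⊗[ℚ] bettiCohomology X 1}
    (hc : c ∈ thetaClasses ιinf (D.classMapDatum hHD 𝔣 hI ιinf hΔ hη) Θ) :
    (BettiUniverse.pull f 1).baseChange ℂ c ∈
      thetaClasses ιinf' (D'.classMapDatum hHD 𝔣' hI ιinf' hΔ'' hη') Θ' :=
  thetaClasses_map_mem_of_restrict_eq ιinf ιinf' (D.classMapDatum hHD 𝔣 hI ιinf hΔ hη)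
    (D'.classMapDatum hHD 𝔣' hI ιinf' hΔ'' hη') ((BettiUniverse.pull f 1).baseChange ℂ)
    (fun c hc => D.pull_baseChange_mem_hodge_F_one D' hHD hI f hc)
    (fun c => by
      rw [classMapDatum_pull, classMapDatum_pull]
      exact D.coe_classPull_pull_baseChange D' 𝔣 𝔣' hHD hI f hT hf c.2)
    (fun g hg g' h => BallForms.mem_holWeightForms_of_coe_eq _ hg h) hΘ hc

/-- **Theta classes are saturated under the level coverings.** For a covering `f : X' ⟶ X` of ball
quotient surfaces with frames of equal matrix and compatible uniformizations, and spaces of adelic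
forms with `Θ ↪ Θ'` on underlying functions, the pullback `(f^* ⊗ ℂ) c` of a theta class
`c ∈ thetaClasses ιinf (D.classMapDatum …) Θ` is a theta class of `(D'.classMapDatum …, Θ')`.
[cite: Borel1997, §5.14] [cite: VoisinHodgeI2002, §7.3.2] -/
theorem pull_baseChange_mem_thetaClasses
    (hHD : exists_isReal_hodgeModel) (hI : hodgePQ_independent_of_hodgeModel)
    (f : X' ⟶ X) (hT : 𝔣'.t = 𝔣.t)
    (hf : ∀ v ∈ D'.cone, Motives.AlgPoints.map f (D'.unif v) = D.unif v)
    {Θ : Submodule ℂ (weightForms ΓU κ τ)} {Θ' : Submodule ℂ (weightForms ΓU' κ τ)}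
    (hΘ : ∀ F ∈ Θ, ∃ F' ∈ Θ', (F' : GU → (Fin 2 → ℂ)) = F)
    {c : ℂ ⊗[ℚ] bettiCohomology X 1}
    (hc : c ∈ thetaClasses ιinf (D.classMapDatum hHD 𝔣 hI ιinf hΔ hη) Θ) :
    (BettiUniverse.pull f 1).baseChange ℂ c ∈
      thetaClasses ιinf (D'.classMapDatum hHD 𝔣' hI ιinf hΔ' hη) Θ' :=
  thetaClasses_map_mem ιinf (D.classMapDatum hHD 𝔣 hI ιinf hΔ hη)
    (D'.classMapDatum hHD 𝔣' hI ιinf hΔ' hη) ((BettiUniverse.pull f 1).baseChange ℂ)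
    (fun c hc => D.pull_baseChange_mem_hodge_F_one D' hHD hI f hc)
    (fun c => by
      rw [classMapDatum_pull, classMapDatum_pull]
      exact D.coe_classPull_pull_baseChange D' 𝔣 𝔣' hHD hI f hT hf c.2)
    (fun g hg g' h => BallForms.mem_holWeightForms_of_coe_eq _ hg h) hΘ hc

/-- **Theta classes are saturated under the level coverings, standard case** `ΓU' ≤ ΓU` with the theta
forms of level `ΓU` contained in those of level `ΓU'` through `WeightForms.mono_left`.
[cite: Borel1997, §5.14] [cite: VoisinHodgeI2002, §7.3.2] -/
theorem pull_baseChange_mem_thetaClasses_of_le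
    (hHD : exists_isReal_hodgeModel) (hI : hodgePQ_independent_of_hodgeModel)
    (f : X' ⟶ X) (hT : 𝔣'.t = 𝔣.t)
    (hf : ∀ v ∈ D'.cone, Motives.AlgPoints.map f (D'.unif v) = D.unif v) (hle : ΓU' ≤ ΓU)
    {Θ : Submodule ℂ (weightForms ΓU κ τ)} {Θ' : Submodule ℂ (weightForms ΓU' κ τ)}
    (hΘ : ∀ F ∈ Θ, (⟨(F : GU → (Fin 2 → ℂ)), WeightForms.mono_left hle F.2⟩ : weightForms ΓU' κ τ) ∈ Θ')
    {c : ℂ ⊗[ℚ] bettiCohomology X 1}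
    (hc : c ∈ thetaClasses ιinf (D.classMapDatum hHD 𝔣 hI ιinf hΔ hη) Θ) :
    (BettiUniverse.pull f 1).baseChange ℂ c ∈
      thetaClasses ιinf (D'.classMapDatum hHD 𝔣' hI ιinf hΔ' hη) Θ' :=
  D.pull_baseChange_mem_thetaClasses D' 𝔣 𝔣' ιinf hΔ hΔ' hη hHD hI f hT hf
    (fun F hF => ⟨_, hΘ F hF, rfl⟩) hc

/-- The same as an inclusion of images. [folklore] -/
theorem thetaClasses_image_pull_baseChange_subset
    (hHD : exists_isReal_hodgeModel) (hI : hodgePQ_independent_of_hodgeModel)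
    (f : X' ⟶ X) (hT : 𝔣'.t = 𝔣.t)
    (hf : ∀ v ∈ D'.cone, Motives.AlgPoints.map f (D'.unif v) = D.unif v)
    {Θ : Submodule ℂ (weightForms ΓU κ τ)} {Θ' : Submodule ℂ (weightForms ΓU' κ τ)}
    (hΘ : ∀ F ∈ Θ, ∃ F' ∈ Θ', (F' : GU → (Fin 2 → ℂ)) = F) :
    (BettiUniverse.pull f 1).baseChange ℂ '' thetaClasses ιinf (D.classMapDatum hHD 𝔣 hI ιinf hΔ hη) Θ ⊆
      thetaClasses ιinf (D'.classMapDatum hHD 𝔣' hI ιinf hΔ' hη) Θ' := by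
  rintro _ ⟨c, hc, rfl⟩
  exact D.pull_baseChange_mem_thetaClasses D' 𝔣 𝔣' ιinf hΔ hΔ' hη hHD hI f hT hf hΘ hc

end ThetaClasses

end UnitaryBallUniformisationDatum

end Literature.AlgebraicGeometry.ShimuraVarieties

end
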